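import Summits.CriticalPhenomena.PercolationContinuityZ3.Theorems.PercNearOneGluingNoHeavyQuantSGCCellMembers
import Summits.CriticalPhenomena.PercolationContinuityZ3.Theorems.PercNearOneGluingNoHeavyQuantSGCCellCertificate
import HarnessLib

/-!
# QUANT lane R8, Route 1 (`SingleGateConvClosed`): the ROW CERTIFICATE — average the product price over the SECOND factor first;
# a `μ₂`-averaged price function dominated by price systems of the FIRST gated factor plus ONE mean tilt gives DEC of the gated product

builds on p205010 (kernel theorem, internal audit signed; external expert review pending)

Support file (`--supports stmt-CriticalPhenomena-4575`), QUANT lane seat prim-quant-arm-2 (gen 43), rung R8 of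
`run/shared/lean/prim/quant/LADDER.md`; memo `run/shared/lean/prim/quant/prim-quant-arm-2-g43/ROWCERT-G43.md`.  Theorems only,
standard axioms, no sorries, no definitions.  Continues arm-2 g41's `…QuantSGCCellCertificate` (the cellwise principle
`sum_test_nonpos_of_cellCert` / `flowAtT_gate_lconv_of_cellCert`) and arm-2 g42's `…QuantSGCCellMembers` (members of a certificate are
price systems of the gated factors: `sum_mu_mul_members_nonpos`, `decAt_gate_allLayers`).

WHY.  The dual route to `LawDec.SingleGateConvClosed` at a layer `j` asks, for every price system `(α, β)` of the gated product
`ν = gate (lconv M₁ M₂ μ₁ μ₂) q`, for `Σ_h f h·ν h ≤ 0` (`f = α` on the lows, `−β` elsewhere; strong duality `flowAtT_of_prices`).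
The lane's CELLWISE certificates (arm-2 g41/g42: dominate the cell price `q·f(i+k) + (1−q)·f 0` on every charged cell `(i, k)` by row
members + column members + two tilts) prove MORE than needed: by LP duality a cellwise certificate exists iff the conclusion holds for
every bi-mean cell MATRIX with admissible lines on the support (`LawDec.MatrixSGC`, support-restricted), which is genuinely stronger than
SGC (the matrix cone has non-product vertices, memo CERT-MEMBERS-G42 §5) and for which members at the natural layers do NOT suffice
(memo MATRIX-SGC-G41 §2, exact witnesses).  Averaging the cell inequality over the second factor FIRST gives the exact dual of SGC:
writing `Σ_h f h·ν h = Σ_i μ₁ i·c̄ i` with the `μ₂`-AVERAGED PRICE `c̄ i = Σ_k μ₂ k·(q·f(i+k) + (1−q)·f 0)` (`sum_test_gate_lconv_rows`),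
the product inequality follows as soon as `c̄` is dominated ON THE SUPPORT OF `μ₁` by ONE row certificate `R` (`Σ_i μ₁ i·R i ≤ 0`, e.g. a
nonnegative combination of price systems of `gate μ₁ q` at any layers) plus ONE tilt `λ·(i − T₁)` plus a constant `σ ≤ 0`
(`sum_test_nonpos_of_rowCert`).  Column members disappear (averaged against `μ₂` they are nonpositive constants), the column tilt vanishes,
and NO admissibility datum of `μ₂` is an input of the theorem: the second factor enters only through the weights `μ₂ k` of the average —
its admissibility is what the USER of the theorem spends when verifying the domination.  By LP duality over `μ₁` alone (the polytope of
laws on a fixed support with mean `T₁` whose gated version is DEC at the layers used), a row certificate exists iff the conclusion holds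
for every such first factor, so this interface is COMPLETE for `SingleGateConvClosed` (the cellwise one is complete only for `MatrixSGC`);
every cellwise certificate averages to a row certificate (`rowCert_of_cellCert`).
EVIDENCE that the reformulation matters (arm-2 g43, exact LPs, memo ROWCERT-G43 §2–§3): on the 133 hardest systems of arm-2 g42's census
(the non-tilt 'OWN_FAIL' product threshold systems) and on 12 964 extreme product price systems of 400 boundary-pushed admissible pairs
(`M ≤ 5`, `q ∈ {1, .95, .9, .75, .5}`), a row certificate by price systems of `gate μ₁ q` at the NATURAL LAYERS `{j − s : μ₂ s > 0} ∪ {0}`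
alone exists in 133/133 and 12 964/12 964 cases (cellwise natural-layer certificates fail on an open set), with the natural weights
(giant price of layer `j − s` equal to `μ₂ s`) in 84 % of them.

* `LawDec.sum_test_gate_lconv_rows` — `Σ_h f h·gate (lconv μ₁ μ₂) q h = Σ_i μ₁ i·Σ_k μ₂ k·(q·f(i+k) + (1−q)·f 0)` (masses `1`).
* **`LawDec.sum_test_nonpos_of_rowCert`** — row domination `c̄ i ≤ R i + λ·(i − T₁) + σ` (`i ≤ M₁`), `Σ_i μ₁ i·R i ≤ 0`, `σ ≤ 0`
  ⟹ `Σ_h f h·gate (lconv μ₁ μ₂) q h ≤ 0`.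
* `LawDec.rowCert_of_cellCert` — a cellwise certificate (arm-2 g41's shape) averages to a row certificate.
* **`LawDec.flowAtT_gate_lconv_of_rowCert`** — if every price system of the product structure at `(j, T)` admits a row certificate,
  then `FlowAtT x T j (M₁+M₂) (gate (lconv M₁ M₂ μ₁ μ₂) q)` (strong duality).
* **`LawDec.decAt_gate_lconv_of_rowMembers`** — the typed form: weights `θ L ≥ 0` on price systems of `gate μ₁ q` at layers `L < N₁`
  where it is DEC, one tilt and one constant `σ ≤ 0`, dominating the `μ₂`-averaged product price on the CHARGED atoms of `μ₁`
  ⟹ `DECAt y j (M₁+M₂) (gate (lconv M₁ M₂ μ₁ μ₂) q)`.  No hypothesis on `gate μ₂ q`.  With `decAt_gate_allLayers` the SGC hypotheses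
  on `μ₁` supply every `N₁`; by `lconv_comm` the roles of the factors may be exchanged.
HONEST STATUS: `SingleGateConvClosed` is OPEN; this is proof infrastructure for its dual route (no closed-form certificate is claimed);
the RATE class log\* and the honest sentence of `run/shared/lean/prim/quant/README.md` are unchanged.

[this work]; cellwise principle: prim-quant-arm-2 g41; members: prim-quant-arm-2 g42; weak/strong duality: prim-quant-stmt g22,
prim-quant-census-2 g54 (this lane).  LP duality [cite: Schrijver1986, Cor 7.1f (p. 90)].  The gluing rows served
[cite: KozmaNitzan2024, Conjecture 3 (p. 15)]; product measure [cite: Grimmett1999, §1.3 p. 10].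
-/

noncomputable section

namespace Summit.CriticalPhenomena.PercolationContinuityZ3.Theorems

namespace Quant

open Finset

namespace LawDec

/-- the price vector of a price system (local notation, as in `…QuantSGCCellMembers`). -/
local notation3 "PV[" T ", " L ", " α ", " β ", " h "]" =>
  (if (h : ℕ) ≤ (L : ℕ) ∧ 2 * ((h : ℕ) : ℝ) < (T : ℝ) then (α : ℕ → ℝ) h else -(β : ℕ → ℝ) h)

/-! ### The product functional as a sum over the rows of the first factor -/

/-- **the product functional, averaged over the second factor first**: for laws `μ₁`, `μ₂` of mass `1` on `{0..M₁}`, `{0..M₂}`,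
`Σ_{h ≤ M₁+M₂} f h · gate (lconv μ₁ μ₂) q h = Σ_{i ≤ M₁} μ₁ i · Σ_{k ≤ M₂} μ₂ k · (q·f(i+k) + (1−q)·f 0)`. [this work] -/
theorem sum_test_gate_lconv_rows (M₁ M₂ : ℕ) (μ₁ μ₂ f : ℕ → ℝ) (q : ℝ)
    (hμ1 : ∑ i ∈ Finset.range (M₁ + 1), μ₁ i = 1) (hμ2 : ∑ k ∈ Finset.range (M₂ + 1), μ₂ k = 1) :
    ∑ h ∈ Finset.range (M₁ + M₂ + 1), f h * gate (lconv M₁ M₂ μ₁ μ₂) q h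
      = ∑ i ∈ Finset.range (M₁ + 1), μ₁ i * ∑ k ∈ Finset.range (M₂ + 1), μ₂ k * (q * f (i + k) + (1 - q) * f 0) := by
  rw [sum_test_gate_lconv]
  -- each row: `μ₁ i·Σ_k μ₂ k·(q f(i+k) + (1−q) f 0) = q·Σ_k μ₁ i μ₂ k f(i+k) + (1−q)·f 0·μ₁ i` (mass of `μ₂` is `1`)
  have hrow : ∀ i : ℕ, μ₁ i * ∑ k ∈ Finset.range (M₂ + 1), μ₂ k * (q * f (i + k) + (1 - q) * f 0)
      = q * ∑ k ∈ Finset.range (M₂ + 1), μ₁ i * μ₂ k * f (i + k) + (1 - q) * f 0 * μ₁ i := by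
    intro i
    have e : ∀ k : ℕ, μ₂ k * (q * f (i + k) + (1 - q) * f 0) = q * (μ₂ k * f (i + k)) + ((1 - q) * f 0) * μ₂ k := by
      intro k; ring
    simp_rw [e]
    rw [Finset.sum_add_distrib, ← Finset.mul_sum, ← Finset.mul_sum, hμ2, mul_one, mul_add, Finset.mul_sum, Finset.mul_sum,
      Finset.mul_sum]
    congr 1
    · refine Finset.sum_congr rfl fun k _ => ?_; ring
    · ring
  simp_rw [hrow]
  rw [Finset.sum_add_distrib, ← Finset.mul_sum, ← Finset.mul_sum, hμ1, mul_one]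

/-! ### The row-certificate principle -/

/-- **ROW DOMINATION ⟹ THE PRODUCT FUNCTIONAL IS NONPOSITIVE.**  Let `μ₁ ≥ 0` have mass `1` and mean `T₁` on `{0..M₁}` and `μ₂` have
mass `1` on `{0..M₂}`, `q` real.  Suppose a row certificate `R` (`Σ_i μ₁ i · R i ≤ 0` — e.g. a nonnegative combination of DEC price
inequalities of `gate μ₁ q` written per unit of `μ₁`-mass), a tilt `lam` and a constant `sig ≤ 0` dominate the `μ₂`-AVERAGED price of
the test function `f` on every atom `i ≤ M₁`:  `Σ_k μ₂ k·(q·f(i+k) + (1−q)·f 0) ≤ R i + lam·(i − T₁) + sig`.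
Then `Σ_{h ≤ M₁+M₂} f h · gate (lconv M₁ M₂ μ₁ μ₂) q h ≤ 0`. [this work] -/
theorem sum_test_nonpos_of_rowCert (M₁ M₂ : ℕ) (μ₁ μ₂ : ℕ → ℝ) (q T₁ : ℝ) (f : ℕ → ℝ)
    (R : ℕ → ℝ) (lam sig : ℝ)
    (h10 : ∀ i, 0 ≤ μ₁ i)
    (hμ1 : ∑ i ∈ Finset.range (M₁ + 1), μ₁ i = 1) (hμ2 : ∑ k ∈ Finset.range (M₂ + 1), μ₂ k = 1)
    (hT1 : ∑ i ∈ Finset.range (M₁ + 1), (i : ℝ) * μ₁ i = T₁)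
    (hrow : ∑ i ∈ Finset.range (M₁ + 1), μ₁ i * R i ≤ 0) (hsig : sig ≤ 0)
    (hdom : ∀ i, i ≤ M₁ →
      ∑ k ∈ Finset.range (M₂ + 1), μ₂ k * (q * f (i + k) + (1 - q) * f 0) ≤ R i + lam * ((i : ℝ) - T₁) + sig) :
    ∑ h ∈ Finset.range (M₁ + M₂ + 1), f h * gate (lconv M₁ M₂ μ₁ μ₂) q h ≤ 0 := by
  rw [sum_test_gate_lconv_rows M₁ M₂ μ₁ μ₂ f q hμ1 hμ2]
  -- integrate the row bound against the nonnegative masses `μ₁ i`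
  have hle : ∑ i ∈ Finset.range (M₁ + 1), μ₁ i * ∑ k ∈ Finset.range (M₂ + 1), μ₂ k * (q * f (i + k) + (1 - q) * f 0)
      ≤ ∑ i ∈ Finset.range (M₁ + 1), μ₁ i * (R i + lam * ((i : ℝ) - T₁) + sig) :=
    Finset.sum_le_sum fun i hi =>
      mul_le_mul_of_nonneg_left (hdom i (Nat.le_of_lt_succ (Finset.mem_range.1 hi))) (h10 i)
  refine hle.trans ?_
  -- split into the certificate, the tilt (integrates to zero) and the constant
  have e : ∀ i : ℕ, μ₁ i * (R i + lam * ((i : ℝ) - T₁) + sig)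
      = μ₁ i * R i + (lam * ((i : ℝ) * μ₁ i) - (lam * T₁) * μ₁ i + sig * μ₁ i) := by
    intro i; ring
  have htilt : ∑ i ∈ Finset.range (M₁ + 1), (lam * ((i : ℝ) * μ₁ i) - (lam * T₁) * μ₁ i + sig * μ₁ i) = sig := by
    rw [Finset.sum_add_distrib, Finset.sum_sub_distrib, ← Finset.mul_sum, ← Finset.mul_sum, ← Finset.mul_sum, hT1, hμ1]
    ring
  simp_rw [e]
  rw [Finset.sum_add_distrib, htilt]
  linarith

/-- **A CELLWISE CERTIFICATE AVERAGES TO A ROW CERTIFICATE.**  In the binder of arm-2 g41's `sum_test_nonpos_of_cellCert` (row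
certificates `R k ·`, column certificates `C i ·` with `Σ_k μ₂ k · C i k ≤ 0`, tilts `lam`, `kap`, cellwise domination on all cells
`i ≤ M₁`, `k ≤ M₂`; `μ₂ ≥ 0` of mass `1` and mean `T₂`), the averaged data `R̄ i = Σ_k μ₂ k·R k i`, `λ̄ = Σ_k μ₂ k·lam k`, `σ = 0`
satisfy the hypotheses of `sum_test_nonpos_of_rowCert`: `Σ_i μ₁ i·R̄ i ≤ 0` and the row domination. [this work] -/
theorem rowCert_of_cellCert (M₁ M₂ : ℕ) (μ₁ μ₂ : ℕ → ℝ) (q T₁ T₂ : ℝ) (f : ℕ → ℝ)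
    (R C : ℕ → ℕ → ℝ) (lam kap : ℕ → ℝ)
    (h20 : ∀ k, 0 ≤ μ₂ k)
    (hμ2 : ∑ k ∈ Finset.range (M₂ + 1), μ₂ k = 1)
    (hT2 : ∑ k ∈ Finset.range (M₂ + 1), (k : ℝ) * μ₂ k = T₂)
    (hrow : ∀ k, k ≤ M₂ → ∑ i ∈ Finset.range (M₁ + 1), μ₁ i * R k i ≤ 0)
    (hcol : ∀ i, i ≤ M₁ → ∑ k ∈ Finset.range (M₂ + 1), μ₂ k * C i k ≤ 0)
    (hcell : ∀ i k, i ≤ M₁ → k ≤ M₂ →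
      q * f (i + k) + (1 - q) * f 0 ≤ R k i + C i k + lam k * ((i : ℝ) - T₁) + kap i * ((k : ℝ) - T₂)) :
    (∑ i ∈ Finset.range (M₁ + 1), μ₁ i * (∑ k ∈ Finset.range (M₂ + 1), μ₂ k * R k i) ≤ 0) ∧
    (∀ i, i ≤ M₁ →
      ∑ k ∈ Finset.range (M₂ + 1), μ₂ k * (q * f (i + k) + (1 - q) * f 0)
        ≤ (∑ k ∈ Finset.range (M₂ + 1), μ₂ k * R k i) + (∑ k ∈ Finset.range (M₂ + 1), μ₂ k * lam k) * ((i : ℝ) - T₁) + 0) := by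
  refine ⟨?_, fun i hi => ?_⟩
  · -- `Σ_i μ₁ i Σ_k μ₂ k R k i = Σ_k μ₂ k (Σ_i μ₁ i R k i) ≤ 0`
    have e : ∑ i ∈ Finset.range (M₁ + 1), μ₁ i * (∑ k ∈ Finset.range (M₂ + 1), μ₂ k * R k i)
        = ∑ k ∈ Finset.range (M₂ + 1), μ₂ k * ∑ i ∈ Finset.range (M₁ + 1), μ₁ i * R k i := by
      simp_rw [Finset.mul_sum]
      rw [Finset.sum_comm]
      refine Finset.sum_congr rfl fun k _ => Finset.sum_congr rfl fun i _ => ?_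
      ring
    rw [e]
    exact Finset.sum_nonpos fun k hk =>
      mul_nonpos_of_nonneg_of_nonpos (h20 k) (hrow k (Nat.le_of_lt_succ (Finset.mem_range.1 hk)))
  · -- average the cell inequality over `k` with the weights `μ₂ k`
    have hle : ∑ k ∈ Finset.range (M₂ + 1), μ₂ k * (q * f (i + k) + (1 - q) * f 0)
        ≤ ∑ k ∈ Finset.range (M₂ + 1), μ₂ k * (R k i + C i k + lam k * ((i : ℝ) - T₁) + kap i * ((k : ℝ) - T₂)) :=
      Finset.sum_le_sum fun k hk =>
        mul_le_mul_of_nonneg_left (hcell i k hi (Nat.le_of_lt_succ (Finset.mem_range.1 hk))) (h20 k)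
    refine hle.trans ?_
    have e : ∀ k : ℕ, μ₂ k * (R k i + C i k + lam k * ((i : ℝ) - T₁) + kap i * ((k : ℝ) - T₂))
        = μ₂ k * R k i + (μ₂ k * C i k + ((μ₂ k * lam k) * ((i : ℝ) - T₁)
          + (kap i * ((k : ℝ) * μ₂ k) - (kap i * T₂) * μ₂ k))) := by
      intro k; ring
    have hkap : ∑ k ∈ Finset.range (M₂ + 1), (kap i * ((k : ℝ) * μ₂ k) - (kap i * T₂) * μ₂ k) = 0 := by
      rw [Finset.sum_sub_distrib, ← Finset.mul_sum, ← Finset.mul_sum, hT2, hμ2]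
      ring
    simp_rw [e]
    rw [Finset.sum_add_distrib, Finset.sum_add_distrib, Finset.sum_add_distrib, hkap, add_zero, ← Finset.sum_mul]
    have hc := hcol i hi
    linarith

/-- **THE ROW-CERTIFICATE PRINCIPLE FOR THE GATED PRODUCT.**  Let `μ₁ ≥ 0` have mass `1` and mean `T₁` on `{0..M₁}`, `μ₂` mass `1` on
`{0..M₂}`, `0 < x < 1`, `q` real, a layer `j < M₁ + M₂` and a target `T`.  If EVERY price system `(α, β)` of the product structure at
`(j, T)` (`β ≥ 0`; `α l ≤ usage(l,h)·β h` for lows `l ≤ j`, `2l < T` and compatible absorbers `h ≤ M₁+M₂`) admits a ROW certificate —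
`R` with `Σ_i μ₁ i·R i ≤ 0`, a tilt `lam`, a constant `sig ≤ 0`, dominating on every `i ≤ M₁` the `μ₂`-average
`Σ_k μ₂ k·(q·f(i+k) + (1−q)·f 0)` of the price test function (`f h = α h` on the lows, `−β h` elsewhere) — then
`FlowAtT x T j (M₁+M₂) (gate (lconv M₁ M₂ μ₁ μ₂) q)`.  (Strong duality `flowAtT_of_prices` + `sum_test_nonpos_of_rowCert`.) [this work] -/
theorem flowAtT_gate_lconv_of_rowCert (x T q : ℝ) (j M₁ M₂ : ℕ) (μ₁ μ₂ : ℕ → ℝ) (T₁ : ℝ)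
    (h10 : ∀ i, 0 ≤ μ₁ i)
    (hμ1 : ∑ i ∈ Finset.range (M₁ + 1), μ₁ i = 1) (hμ2 : ∑ k ∈ Finset.range (M₂ + 1), μ₂ k = 1)
    (hT1 : ∑ i ∈ Finset.range (M₁ + 1), (i : ℝ) * μ₁ i = T₁)
    (hj : j < M₁ + M₂)
    (hcert : ∀ α β : ℕ → ℝ, (∀ h, 0 ≤ β h) →
      (∀ l h, l ≤ j → 2 * (l : ℝ) < T → h ≤ M₁ + M₂ → (j + 1 ≤ h ∨ T < (l : ℝ) + h) →
        α l ≤ usage x T j l h * β h) →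
      ∃ (R : ℕ → ℝ) (lam sig : ℝ),
        (∑ i ∈ Finset.range (M₁ + 1), μ₁ i * R i ≤ 0) ∧ sig ≤ 0 ∧
        (∀ i, i ≤ M₁ →
          ∑ k ∈ Finset.range (M₂ + 1), μ₂ k *
              (q * (if i + k ≤ j ∧ 2 * ((i + k : ℕ) : ℝ) < T then α (i + k) else -β (i + k))
                + (1 - q) * (if 0 ≤ j ∧ 2 * ((0 : ℕ) : ℝ) < T then α 0 else -β 0))
            ≤ R i + lam * ((i : ℝ) - T₁) + sig)) :
    FlowAtT x T j (M₁ + M₂) (gate (lconv M₁ M₂ μ₁ μ₂) q) := by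
  classical
  refine flowAtT_of_prices x T j (M₁ + M₂) _ fun α β hβ hαβ => ?_
  obtain ⟨R, lam, sig, hrow, hsig, hdom⟩ := hcert α β hβ hαβ
  set ν := gate (lconv M₁ M₂ μ₁ μ₂) q with hν
  set f : ℕ → ℝ := fun h => if h ≤ j ∧ 2 * (h : ℝ) < T then α h else -β h with hf
  have key : ∑ h ∈ Finset.range (M₁ + M₂ + 1), f h * ν h ≤ 0 := by
    refine sum_test_nonpos_of_rowCert M₁ M₂ μ₁ μ₂ q T₁ f R lam sig h10 hμ1 hμ2 hT1 hrow hsig ?_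
    intro i hi
    have h0 : f 0 = (if 0 ≤ j ∧ 2 * ((0 : ℕ) : ℝ) < T then α 0 else -β 0) := by simp only [hf]
    have hik : ∀ k : ℕ, f (i + k) = (if i + k ≤ j ∧ 2 * ((i + k : ℕ) : ℝ) < T then α (i + k) else -β (i + k)) := by
      intro k; simp only [hf]
    simp_rw [hik, h0]
    exact hdom i hi
  -- rewrite the two sides of the price inequality as one sum of `f h · ν h`
  have hsplit : ∀ h : ℕ, f h * ν h
      = (if h ≤ j ∧ 2 * (h : ℝ) < T then α h * ν h else 0) - (if h ≤ j ∧ 2 * (h : ℝ) < T then 0 else β h * ν h) := by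
    intro h
    simp only [hf]
    split_ifs <;> ring
  have hsum : ∑ h ∈ Finset.range (M₁ + M₂ + 1), f h * ν h
      = ∑ h ∈ Finset.range (M₁ + M₂ + 1), (if h ≤ j ∧ 2 * (h : ℝ) < T then α h * ν h else 0)
        - ∑ h ∈ Finset.range (M₁ + M₂ + 1), (if h ≤ j ∧ 2 * (h : ℝ) < T then 0 else β h * ν h) := by
    rw [← Finset.sum_sub_distrib]
    exact Finset.sum_congr rfl fun h _ => hsplit h
  -- the low side lives on `range (j+1) ⊆ range (M₁+M₂+1)`
  have hlow : ∑ l ∈ Finset.range (j + 1), (if 2 * (l : ℝ) < T then α l * ν l else 0)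
      = ∑ h ∈ Finset.range (M₁ + M₂ + 1), (if h ≤ j ∧ 2 * (h : ℝ) < T then α h * ν h else 0) := by
    have hsub : Finset.range (j + 1) ⊆ Finset.range (M₁ + M₂ + 1) :=
      fun h hh => Finset.mem_range.2 (lt_of_lt_of_le (Finset.mem_range.1 hh) (Nat.succ_le_succ hj.le))
    rw [← Finset.sum_subset hsub (fun h _ hj' => by
      have hjlt : ¬ (h ≤ j ∧ 2 * (h : ℝ) < T) := fun hc => hj' (Finset.mem_range.2 (Nat.lt_succ_of_le hc.1))
      rw [if_neg hjlt])]
    refine Finset.sum_congr rfl fun h hh => ?_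
    have hle : h ≤ j := Nat.le_of_lt_succ (Finset.mem_range.1 hh)
    by_cases hlt : 2 * (h : ℝ) < T
    · rw [if_pos hlt, if_pos ⟨hle, hlt⟩]
    · rw [if_neg hlt, if_neg (fun hc => hlt hc.2)]
  rw [hlow]
  linarith [key, hsum]

/-! ### The typed form: members of the first factor -/

/-- **ROW CERTIFICATES BY MEMBERS OF THE FIRST FACTOR ⟹ DEC OF THE GATED PRODUCT** (the `μ₂`-averaged form of arm-2 g42's
`decAt_gate_lconv_of_members`).  Let `0 < y < 1`, `0 ≤ q ≤ 1`, `μ₁`, `μ₂` probability laws on `{0..M₁}`, `{0..M₂}` with means `T₁`,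
`T₂` (`τ₁ = q·T₁`, `τ = q·(T₁ + T₂)`; of `μ₂` only `μ₂ ≥ 0` and the mass and mean sums over `range (M₂+1)` are used), `gate μ₁ q`
DEC at every layer `L < N₁` (floor `y`), and `j < M₁ + M₂`.  Suppose that for every
price system `(α, β)` of the product structure `(y, τ, j, M₁+M₂)` there are weights `θ L ≥ 0` on price systems `(aR L, bR L)` of `ν₁`'s
structures `(y, τ₁, L, M₁)`, `L < N₁`, one tilt `lam` and one constant `sig ≤ 0` such that on every CHARGED atom of `μ₁` (`μ₁ i > 0`,
`i ≤ M₁`)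
`Σ_{k ≤ M₂} μ₂ k·(q·φ(i+k) + (1−q)·φ 0) ≤ Σ_{L<N₁} θ L·(q·v_L i + (1−q)·v_L 0) + lam·(i − T₁) + sig`, `φ = PV[τ, j, α, β`, ],
`v_L` the members' price vectors.  Then `DECAt y j (M₁+M₂) (gate (lconv M₁ M₂ μ₁ μ₂) q)`.  NO hypothesis on `gate μ₂ q` is needed:
the second factor enters only through the weights of the average.  (Uncharged atoms of `μ₁` are padded; the members form a row
certificate by `sum_mu_mul_members_nonpos`; then `flowAtT_gate_lconv_of_rowCert` and `decAt_iff_flowAt`.) [this work] -/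
theorem decAt_gate_lconv_of_rowMembers (y q : ℝ) (M₁ M₂ N₁ j : ℕ) (μ₁ μ₂ : ℕ → ℝ)
    (hy0 : 0 < y) (hy1 : y < 1) (hq0 : 0 ≤ q) (hq1 : q ≤ 1)
    (h10 : ∀ h, 0 ≤ μ₁ h) (h1M : ∀ h, M₁ < h → μ₁ h = 0) (h11 : ∑ h ∈ Finset.range (M₁ + 1), μ₁ h = 1)
    (h20 : ∀ h, 0 ≤ μ₂ h) (h21 : ∑ h ∈ Finset.range (M₂ + 1), μ₂ h = 1)
    (hD1 : ∀ L, L < N₁ → DECAt y L M₁ (gate μ₁ q))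
    (hj : j < M₁ + M₂)
    (hcert : ∀ α β : ℕ → ℝ, (∀ h, 0 ≤ β h) →
      (∀ l h, l ≤ j → 2 * (l : ℝ) < q * ((∑ h ∈ Finset.range (M₁ + 1), (h : ℝ) * μ₁ h) + ∑ h ∈ Finset.range (M₂ + 1), (h : ℝ) * μ₂ h) →
        h ≤ M₁ + M₂ → (j + 1 ≤ h ∨ q * ((∑ h ∈ Finset.range (M₁ + 1), (h : ℝ) * μ₁ h) + ∑ h ∈ Finset.range (M₂ + 1), (h : ℝ) * μ₂ h)
          < (l : ℝ) + h) →
        α l ≤ usage y (q * ((∑ h ∈ Finset.range (M₁ + 1), (h : ℝ) * μ₁ h) + ∑ h ∈ Finset.range (M₂ + 1), (h : ℝ) * μ₂ h))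
          j l h * β h) →
      ∃ (θ : ℕ → ℝ) (aR bR : ℕ → ℕ → ℝ) (lam sig : ℝ),
        (∀ L, 0 ≤ θ L) ∧ (∀ L h, 0 ≤ bR L h) ∧
        (∀ L l h : ℕ, l ≤ L → 2 * (l : ℝ) < q * ∑ h ∈ Finset.range (M₁ + 1), (h : ℝ) * μ₁ h → h ≤ M₁ →
          (L + 1 ≤ h ∨ q * ∑ h ∈ Finset.range (M₁ + 1), (h : ℝ) * μ₁ h < (l : ℝ) + h) →
          aR L l ≤ usage y (q * ∑ h ∈ Finset.range (M₁ + 1), (h : ℝ) * μ₁ h) L l h * bR L h) ∧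
        sig ≤ 0 ∧
        (∀ i, i ≤ M₁ → 0 < μ₁ i →
          ∑ k ∈ Finset.range (M₂ + 1), μ₂ k *
              (q * PV[(q * ((∑ h ∈ Finset.range (M₁ + 1), (h : ℝ) * μ₁ h) + ∑ h ∈ Finset.range (M₂ + 1), (h : ℝ) * μ₂ h)), j, α, β, (i + k)]
                + (1 - q) * PV[(q * ((∑ h ∈ Finset.range (M₁ + 1), (h : ℝ) * μ₁ h) + ∑ h ∈ Finset.range (M₂ + 1), (h : ℝ) * μ₂ h)), j, α, β, 0])
          ≤ (∑ L ∈ Finset.range N₁, θ L *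
                (q * PV[(q * ∑ h ∈ Finset.range (M₁ + 1), (h : ℝ) * μ₁ h), L, (aR L), (bR L), i]
                  + (1 - q) * PV[(q * ∑ h ∈ Finset.range (M₁ + 1), (h : ℝ) * μ₁ h), L, (aR L), (bR L), 0]))
            + lam * ((i : ℝ) - ∑ h ∈ Finset.range (M₁ + 1), (h : ℝ) * μ₁ h) + sig)) :
    DECAt y j (M₁ + M₂) (gate (lconv M₁ M₂ μ₁ μ₂) q) := by
  classical
  set T₁ : ℝ := ∑ h ∈ Finset.range (M₁ + 1), (h : ℝ) * μ₁ h with hT₁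
  set T₂ : ℝ := ∑ h ∈ Finset.range (M₂ + 1), (h : ℝ) * μ₂ h with hT₂
  -- law facts of the gated product
  obtain ⟨hL0, hLM, hL1⟩ := gate_laws (M₁ + M₂) (lconv M₁ M₂ μ₁ μ₂) q hq0 hq1 (lconv_nonneg M₁ M₂ μ₁ μ₂ h10 h20)
    (fun h hh => lconv_eq_zero M₁ M₂ μ₁ μ₂ h hh) (sum_lconv M₁ M₂ μ₁ μ₂ h11 h21)
  have hmean : ∑ h ∈ Finset.range (M₁ + M₂ + 1), (h : ℝ) * gate (lconv M₁ M₂ μ₁ μ₂) q h = q * (T₁ + T₂) := by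
    rw [sum_mul_gate, sum_mul_lconv M₁ M₂ μ₁ μ₂ h11 h21]
  -- DEC hypotheses of the first factor at the explicit target
  have hD1' : ∀ L, L < N₁ → DECAtT y (q * T₁) L M₁ (gate μ₁ q) := by
    intro L hL
    have := hD1 L hL
    rw [decAt_iff_decAtT, sum_mul_gate] at this
    exact this
  rw [decAt_iff_flowAt y j (M₁ + M₂) _ hy0 hy1 hLM hL1, hmean]
  refine flowAtT_gate_lconv_of_rowCert y (q * (T₁ + T₂)) q j M₁ M₂ μ₁ μ₂ T₁ h10 h11 h21 rfl hj ?_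
  intro α β hβ hαβ
  obtain ⟨θ, aR, bR, lam, sig, hθ, hbR, hvR, hsig, hdom⟩ := hcert α β hβ hαβ
  -- the members, the padding on uncharged atoms
  set rowM : ℕ → ℝ := fun i => ∑ L ∈ Finset.range N₁, θ L *
      (q * PV[(q * T₁), L, (aR L), (bR L), i] + (1 - q) * PV[(q * T₁), L, (aR L), (bR L), 0]) with hrowM
  set lhs : ℕ → ℝ := fun i => ∑ k ∈ Finset.range (M₂ + 1), μ₂ k *
      (q * PV[(q * (T₁ + T₂)), j, α, β, (i + k)] + (1 - q) * PV[(q * (T₁ + T₂)), j, α, β, 0]) with hlhs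
  set pad : ℕ → ℝ := fun i => max 0 (lhs i - (rowM i + lam * ((i : ℝ) - T₁) + sig)) with hpad
  refine ⟨fun i => rowM i + (if μ₁ i = 0 then pad i else 0), lam, sig, ?_, hsig, ?_⟩
  · -- the row certificate: the padding sits on `μ₁`-null atoms
    have e : ∑ i ∈ Finset.range (M₁ + 1), μ₁ i * (rowM i + (if μ₁ i = 0 then pad i else 0))
        = ∑ i ∈ Finset.range (M₁ + 1), μ₁ i * rowM i := by
      refine Finset.sum_congr rfl fun i _ => ?_
      by_cases hz : μ₁ i = 0
      · rw [hz, zero_mul, zero_mul]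
      · rw [if_neg hz, add_zero]
    rw [e, hrowM]
    exact sum_mu_mul_members_nonpos y (q * T₁) q N₁ M₁ μ₁ θ aR bR hy0 hy1 hθ h1M h11 hD1' hbR hvR
  · -- rows: charged atoms by the certificate, the others by the padding
    intro i hi
    have hgoal : lhs i ≤ rowM i + (if μ₁ i = 0 then pad i else 0) + lam * ((i : ℝ) - T₁) + sig := by
      have hpad0 : 0 ≤ pad i := le_max_left _ _
      have hpad1 : lhs i - (rowM i + lam * ((i : ℝ) - T₁) + sig) ≤ pad i := le_max_right _ _
      by_cases hz1 : μ₁ i = 0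
      · rw [if_pos hz1]; linarith
      · rw [if_neg hz1, add_zero]
        have hc := hdom i hi (lt_of_le_of_ne (h10 i) (Ne.symm hz1))
        simp only [hlhs, hrowM]
        exact hc
    have elhs : lhs i = ∑ k ∈ Finset.range (M₂ + 1), μ₂ k *
        (q * (if i + k ≤ j ∧ 2 * ((i + k : ℕ) : ℝ) < q * (T₁ + T₂) then α (i + k) else -β (i + k))
          + (1 - q) * (if 0 ≤ j ∧ 2 * ((0 : ℕ) : ℝ) < q * (T₁ + T₂) then α 0 else -β 0)) := by
      simp only [hlhs]
    rw [← elhs]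
    exact hgoal

end LawDec

end Quant

end Summit.CriticalPhenomena.PercolationContinuityZ3.Theorems
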